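import Summits.HubbardSuperconductivity.HubbardSuperconductivity.Theses.ThermalWedge
import Summits.HubbardSuperconductivity.HubbardSuperconductivity.Theorems.ThermalWedgeTwSourcedInertnessReduction
import Literature.MathematicalPhysics.QuantumLattice.DWaveSourceFreePressure

/-!
# Crux `TwSourcedInertness` (item `stmt-HubbardSuperconductivity-1696`): the exact free gain and
# zero-mode lower bounds — support lemmas from the standing disprover (cycle 2)

The crux asks, eventually in `L`, for `p̃_L(β,μ,U,h) − p̃_L(β,μ,U,0) ≤ C(1 + log β)h²` for all real `h`,
`0 < U ≤ U₀`, `1 ≤ β ≤ e^{a/U}`, `μ` in a compact of `(−4,0)`, where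
`p̃_L(β,μ,U,h) = log Re Z_β(dWaveSourceTorus L U μ h)/(βL²)` (spelled out; no definition is
introduced). With `F(y) := log((1 + cosh y)/2)` (written out everywhere) this file proves:

* the free level `ε = −1` of every `3j`-torus through `q = (j,0)` (`torusBand_qOn`, `dWaveGap_qOn`);
* the elementary `F`-calculus (`bdgF_*`, `one_le_bdgF_three_sqrt_two : 1 ≤ F(3√2)`,
  `bdgF_two_mul_le : F(2y) ≤ 2F(y) + 2 log 2`);
* `free_gain_eq` — the EXACT `U = 0` gain from the tree's BdG formula
  (`log_partitionFn_dWaveSourceTorus_zero_sub`): `p̃_L(β,μ,0,s) − p̃_L(β,μ,0,0) =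
  (βL²)⁻¹ Σ_k [F(βE_k(s)) − F(βξ_k)]`, `E_k² = ξ_k² + 8s²ĝ_d(k)²`, each mode gaining (`modeGain_nonneg`);
* `free_gain_sub_le_gain` — `G_U(h) ≥ G_0(h) − 2|U|` (from the route's
  `abs_sourcedPressure_interacting_sub_free_le`), hence `level_gain_lower_bound`:
  `F(β·2√2|h ĝ_d(q)|)/(βL²) − 2|U| ≤ G_U(h)` on a torus with a free level at `μ` through `q`;
* bookkeeping `one_add_log_sq_le`, `le_exp_div_of_le` (choosing `U ≤ a/(1 + log β)` keeps `β ≤ e^{a/U}`).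

Used by the sibling files `StubThresholds` (the lead's two stubs need `L₀ = L₀(β)`),
`ThermalRowWalk` / `ThermalCooperLog` (the `log β` of the crux is sharp).
Sources: BCS 1957 §III; von Delft–Ralph, Phys. Rep. 345 (2001) §4.2 (BdG levels; tree
`DWaveSourceFreePressure`); B. Simon, *Statistical Mechanics of Lattice Gases* I §II (Lipschitz
continuity of `log Z`; tree `ApproximatingHamiltonianProofs`). Work file with the census:
`Cruxes/TwSourcedInertness/Disproof.lean` §H–§J.
-/

noncomputable section

namespace Summit.HubbardSuperconductivity.HubbardSuperconductivity.Theorems.TwSourcedInertness.Negative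

open Matrix Finset Literature.MathematicalPhysics.QuantumLattice Literature.Probability.LatticeModels

/-! ### The zero mode `q = (j, 0)` of the `3j`-torus at `μ = −1` -/

/-- `cos(2π/3) = −1/2`. [folklore] -/
theorem cos_two_pi_div_three : Real.cos (2 * Real.pi * 1 / 3) = -1 / 2 := by
  rw [show 2 * Real.pi * 1 / 3 = Real.pi - Real.pi / 3 by ring, Real.cos_pi_sub, Real.cos_pi_div_three]
  norm_num

/-- First coordinate of the shell momentum `q = (j, 0)` of the `3j`-torus. [folklore] -/
theorem val_qOn_zero {j : ℕ} (hj : 1 ≤ j) : (((![((j : ℕ) : ZMod (3 * j)), 0] : TorusSite 2 (3 * j))) 0).val = j := by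
  rw [Matrix.cons_val_zero, ZMod.val_natCast]
  exact Nat.mod_eq_of_lt (by omega)

/-- Second coordinate of `q = (j, 0)`. [folklore] -/
theorem qOn_one (j : ℕ) : ((![((j : ℕ) : ZMod (3 * j)), 0] : TorusSite 2 (3 * j))) 1 = 0 := by
  simp

/-- `cos(2πj/(3j)) = −1/2`. [folklore] -/
theorem cos_latticeMomentum_qOn_zero {j : ℕ} (hj : 1 ≤ j) :
    Real.cos (latticeMomentum (3 * j) ((![((j : ℕ) : ZMod (3 * j)), 0] : TorusSite 2 (3 * j))) 0) = -1 / 2 := by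
  unfold latticeMomentum
  rw [val_qOn_zero hj]
  have hj0 : (j : ℝ) ≠ 0 := by exact_mod_cast (show j ≠ 0 by omega)
  rw [show (2 * Real.pi * (j : ℝ) / ((3 * j : ℕ) : ℝ)) = 2 * Real.pi * 1 / 3 by push_cast; field_simp]
  exact cos_two_pi_div_three

/-- `cos 0 = 1` for the second coordinate of `q = (j,0)`. [folklore] -/
theorem cos_latticeMomentum_qOn_one (j : ℕ) :
    Real.cos (latticeMomentum (3 * j) ((![((j : ℕ) : ZMod (3 * j)), 0] : TorusSite 2 (3 * j))) 1) = 1 := by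
  unfold latticeMomentum
  rw [qOn_one, ZMod.val_zero]
  simp

/-- **The `3j`-torus carries the free level `ε = −1`** through `q = (j, 0)`. [folklore] -/
theorem torusBand_qOn {j : ℕ} (hj : 1 ≤ j) : torusBand (3 * j) ((![((j : ℕ) : ZMod (3 * j)), 0] : TorusSite 2 (3 * j))) = -1 := by
  rw [torusBand, Fin.sum_univ_two, cos_latticeMomentum_qOn_zero hj, cos_latticeMomentum_qOn_one]
  norm_num

/-- The `d`-wave form factor at `q = (j,0)` is `−3/2`. [folklore] -/
theorem dWaveGap_qOn {j : ℕ} (hj : 1 ≤ j) : dWaveGap ((![((j : ℕ) : ZMod (3 * j)), 0] : TorusSite 2 (3 * j))) = -3 / 2 := by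
  rw [dWaveGap, cos_latticeMomentum_qOn_zero hj, cos_latticeMomentum_qOn_one]
  norm_num

/-! ## The exact free gain (BdG formula for `U = 0`, tree `DWaveSourceFreePressure`)

The tree PROVES the closed form of the `U = 0` sourced pressure
(`log_partitionFn_dWaveSourceTorus_zero_sub`, `L ≥ 3`):
`log Z_L(β,μ,0,s) − log Z_L(β,μ,0,0) = Σ_k [F(βE_k(s)) − F(βξ_k)]`, `F(y) = log((1+cosh y)/2)`,
`ξ_k = ε_L(k) − μ`, `E_k(s)² = ξ_k² + 8 s² ĝ_d(k)²`. Combined with `|p̃(U) − p̃(0)| ≤ |U|`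
(`abs_sourcedPressure_interacting_sub_free_le`, Theorems file of the route) every LOWER bound on
the free gain transfers to the interacting gain up to `2|U|`. This section packages the per-mode
gain `modeGain` and its elementary bounds. -/

section FreeGain

/-- `1 ≤ (1 + cosh y)/2`. [folklore] -/
theorem one_le_bdgF_arg (y : ℝ) : 1 ≤ (1 + Real.cosh y) / 2 := by
  have := Real.one_le_cosh y; linarith

/-- `0 < (1 + cosh y)/2`. [folklore] -/
theorem bdgF_arg_pos (y : ℝ) : 0 < (1 + Real.cosh y) / 2 :=
  lt_of_lt_of_le one_pos (one_le_bdgF_arg y)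

/-- `F(0) = 0` for `F(y) = log((1 + cosh y)/2)`. [folklore] -/
@[simp] theorem bdgF_zero : Real.log ((1 + Real.cosh 0) / 2) = 0 := by simp

/-- `F ≥ 0`. [folklore] -/
theorem bdgF_nonneg (y : ℝ) : 0 ≤ Real.log ((1 + Real.cosh y) / 2) := Real.log_nonneg (one_le_bdgF_arg y)

/-- `F` is even. [folklore] -/
theorem bdgF_neg (y : ℝ) : Real.log ((1 + Real.cosh (-y)) / 2) = Real.log ((1 + Real.cosh y) / 2) := by simp [Real.cosh_neg]

/-- `F(|y|) = F(y)`. [folklore] -/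
theorem bdgF_abs (y : ℝ) : Real.log ((1 + Real.cosh |y|) / 2) = Real.log ((1 + Real.cosh y) / 2) := by
  rcases abs_choice y with h | h
  · rw [h]
  · rw [h, bdgF_neg]

/-- `F` is monotone in `|y|`. -/
theorem bdgF_le_bdgF_of_abs_le {x y : ℝ} (hxy : |x| ≤ |y|) : Real.log ((1 + Real.cosh x) / 2) ≤ Real.log ((1 + Real.cosh y) / 2) := by
  refine Real.log_le_log (bdgF_arg_pos x) ?_
  have := Real.cosh_le_cosh.mpr hxy
  linarith

/-- Quadratic lower bound `1 + y²/8 ≤ (1 + cosh y)/2` (from `e^t ≥ 1 + t + t²/2`, `e^{-t} ≥ 1 − t`). -/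
theorem one_add_sq_div_eight_le (y : ℝ) : 1 + y ^ 2 / 8 ≤ (1 + Real.cosh y) / 2 := by
  wlog hy : 0 ≤ y generalizing y
  · have h := this (-y) (by linarith)
    rwa [neg_sq, Real.cosh_neg] at h
  have h1 := Real.quadratic_le_exp_of_nonneg hy
  have h2 := Real.add_one_le_exp (-y)
  rw [Real.cosh_eq]
  linarith

/-- The witness value: `1 ≤ F(3√2)` (`(1 + cosh 3√2)/2 ≥ 1 + 18/8 = 13/4 > e`). -/
theorem one_le_bdgF_three_sqrt_two : 1 ≤ Real.log ((1 + Real.cosh (3 * Real.sqrt 2)) / 2) := by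
  rw [Real.le_log_iff_exp_le (bdgF_arg_pos _)]
  have h := one_add_sq_div_eight_le (3 * Real.sqrt 2)
  have hsq : (3 * Real.sqrt 2) ^ 2 = 18 := by
    rw [mul_pow, Real.sq_sqrt (by norm_num : (0:ℝ) ≤ 2)]; norm_num
  rw [hsq] at h
  have he := Real.exp_one_lt_d9
  linarith

/-- Doubling inequality `F(2y) ≤ 2F(y) + 2 log 2` (`(1 + cosh 2y)/2 = cosh² y ≤ (1 + cosh y)²`). -/
theorem bdgF_two_mul_le (y : ℝ) : Real.log ((1 + Real.cosh (2 * y)) / 2) ≤ 2 * Real.log ((1 + Real.cosh y) / 2) + 2 * Real.log 2 := by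
  set A : ℝ := (1 + Real.cosh y) / 2 with hA
  have hApos : 0 < A := bdgF_arg_pos y
  have hrhs : 2 * Real.log A + 2 * Real.log 2 = Real.log (A ^ 2 * 4) := by
    rw [Real.log_mul (pow_ne_zero 2 hApos.ne') (by norm_num), Real.log_pow,
      show (4 : ℝ) = 2 ^ 2 by norm_num, Real.log_pow]
    push_cast
    ring
  rw [hrhs]
  refine Real.log_le_log (bdgF_arg_pos (2 * y)) ?_
  rw [Real.cosh_two_mul]
  have hc := Real.one_le_cosh y
  have hs : Real.sinh y ^ 2 = Real.cosh y ^ 2 - 1 := by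
    have := Real.cosh_sq y; linarith
  rw [hs, hA]
  nlinarith

variable (L : ℕ) [NeZero L]

/-- **The exact free gain** (`L ≥ 3`):
`p̃_L(β,μ,0,s) − p̃_L(β,μ,0,0) = (βL²)⁻¹ Σ_k modeGain`. -/
theorem free_gain_eq (hL : 3 ≤ L) (β μ s : ℝ) :
    (Real.log (partitionFn β (dWaveSourceTorus L 0 μ s)).re / (β * (L : ℝ) ^ 2)) - (Real.log (partitionFn β (dWaveSourceTorus L 0 μ 0)).re / (β * (L : ℝ) ^ 2)) =
      (∑ k : TorusSite 2 L, (Real.log ((1 + Real.cosh (β * Real.sqrt ((torusBand L k - μ) ^ 2 + (2 * Real.sqrt 2 * s * dWaveGap k) ^ 2))) / 2) - Real.log ((1 + Real.cosh (β * (torusBand L k - μ))) / 2))) / (β * (L : ℝ) ^ 2) := by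
  rw [← sub_div, log_partitionFn_dWaveSourceTorus_zero_sub hL]

omit [NeZero L] in
/-- Each mode gains: `modeGain ≥ 0` for `β ≥ 0` (`E_k(s) ≥ |ξ_k|`, `F` monotone in `|y|`). -/
theorem modeGain_nonneg {β : ℝ} (hβ : 0 ≤ β) (μ s : ℝ) (k : TorusSite 2 L) :
    0 ≤ (Real.log ((1 + Real.cosh (β * Real.sqrt ((torusBand L k - μ) ^ 2 + (2 * Real.sqrt 2 * s * dWaveGap k) ^ 2))) / 2) - Real.log ((1 + Real.cosh (β * (torusBand L k - μ))) / 2)) := by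
  rw [sub_nonneg]
  refine bdgF_le_bdgF_of_abs_le ?_
  rw [abs_mul, abs_mul, abs_of_nonneg hβ, abs_of_nonneg (Real.sqrt_nonneg _)]
  refine mul_le_mul_of_nonneg_left ?_ hβ
  rw [← Real.sqrt_sq_eq_abs]
  exact Real.sqrt_le_sqrt (by nlinarith)

omit [NeZero L] in
/-- A zero mode (`ε_L(k) = μ`) gains `F(β·2√2|s ĝ_d(k)|)`. -/
theorem modeGain_of_level {β μ s : ℝ} {k : TorusSite 2 L} (hk : torusBand L k = μ) :
    (Real.log ((1 + Real.cosh (β * Real.sqrt ((torusBand L k - μ) ^ 2 + (2 * Real.sqrt 2 * s * dWaveGap k) ^ 2))) / 2) - Real.log ((1 + Real.cosh (β * (torusBand L k - μ))) / 2)) = Real.log ((1 + Real.cosh (β * |2 * Real.sqrt 2 * s * dWaveGap k|)) / 2) := by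
  rw [hk, sub_self, mul_zero, bdgF_zero, sub_zero]
  congr 1
  rw [show (0 : ℝ) ^ 2 = 0 by norm_num, zero_add, Real.sqrt_sq_eq_abs]

/-- **One-mode lower bound on the free gain** (`β > 0`, `L ≥ 3`): for every momentum `k₀`,
`modeGain k₀ /(βL²) ≤ p̃_L(β,μ,0,s) − p̃_L(β,μ,0,0)`. -/
theorem modeGain_div_le_free_gain (hL : 3 ≤ L) {β : ℝ} (hβ : 0 < β) (μ s : ℝ) (k₀ : TorusSite 2 L) :
    (Real.log ((1 + Real.cosh (β * Real.sqrt ((torusBand L k₀ - μ) ^ 2 + (2 * Real.sqrt 2 * s * dWaveGap k₀) ^ 2))) / 2) - Real.log ((1 + Real.cosh (β * (torusBand L k₀ - μ))) / 2)) / (β * (L : ℝ) ^ 2) ≤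
      (Real.log (partitionFn β (dWaveSourceTorus L 0 μ s)).re / (β * (L : ℝ) ^ 2)) - (Real.log (partitionFn β (dWaveSourceTorus L 0 μ 0)).re / (β * (L : ℝ) ^ 2)) := by
  rw [free_gain_eq L hL]
  have hβL : 0 < β * (L : ℝ) ^ 2 := mul_pos hβ (cast_sq_pos_of_neZero L)
  rw [div_le_div_iff_of_pos_right hβL]
  exact Finset.single_le_sum (f := fun k => (Real.log ((1 + Real.cosh (β * Real.sqrt ((torusBand L k - μ) ^ 2 + (2 * Real.sqrt 2 * s * dWaveGap k) ^ 2))) / 2) - Real.log ((1 + Real.cosh (β * (torusBand L k - μ))) / 2)))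
    (fun k _ => modeGain_nonneg L hβ.le μ s k) (Finset.mem_univ k₀)

/-- **Free-to-interacting transfer**: `G_U(h) ≥ G_0(h) − 2|U|` (all `L`, `β > 0`). -/
theorem free_gain_sub_le_gain (U μ h : ℝ) {β : ℝ} (hβ : 0 < β) :
    (Real.log (partitionFn β (dWaveSourceTorus L 0 μ h)).re / (β * (L : ℝ) ^ 2)) - (Real.log (partitionFn β (dWaveSourceTorus L 0 μ 0)).re / (β * (L : ℝ) ^ 2)) - 2 * |U| ≤
      (Real.log (partitionFn β (dWaveSourceTorus L U μ h)).re / (β * (L : ℝ) ^ 2)) - (Real.log (partitionFn β (dWaveSourceTorus L U μ 0)).re / (β * (L : ℝ) ^ 2)) := by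
  have h1 := Summit.HubbardSuperconductivity.HubbardSuperconductivity.Theorems.abs_sourcedPressure_interacting_sub_free_le L U μ h hβ
  have h2 := Summit.HubbardSuperconductivity.HubbardSuperconductivity.Theorems.abs_sourcedPressure_interacting_sub_free_le L U μ 0 hβ
  rw [abs_le] at h1 h2
  linarith [h1.1, h2.2]

/-- **The zero-mode witness bound**: on a torus with a level at `μ` through `q`, for `β > 0` and
every `U`, `F(β·2√2|h ĝ_d(q)|)/(βL²) − 2|U| ≤ G_U(h)`. -/
theorem level_gain_lower_bound (hL : 3 ≤ L) {β : ℝ} (hβ : 0 < β) {μ : ℝ} {q : TorusSite 2 L}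
    (hq : torusBand L q = μ) (U h : ℝ) :
    Real.log ((1 + Real.cosh (β * |2 * Real.sqrt 2 * h * dWaveGap q|)) / 2) / (β * (L : ℝ) ^ 2) - 2 * |U| ≤
      (Real.log (partitionFn β (dWaveSourceTorus L U μ h)).re / (β * (L : ℝ) ^ 2)) - (Real.log (partitionFn β (dWaveSourceTorus L U μ 0)).re / (β * (L : ℝ) ^ 2)) := by
  have h1 := modeGain_div_le_free_gain L hL hβ μ h q
  rw [modeGain_of_level L hq] at h1
  have h2 := free_gain_sub_le_gain L U μ h hβ
  linarith

end FreeGain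

/-! ### Elementary bookkeeping for the witnesses -/

/-- Elementary: `log β ≤ 2(√β − 1)` hence `1 + log (t²) ≤ 2t` for `t ≥ 1`. -/
theorem one_add_log_sq_le {t : ℝ} (ht : 1 ≤ t) : 1 + Real.log (t ^ 2) ≤ 2 * t := by
  have ht0 : 0 < t := by linarith
  rw [Real.log_pow]
  have := Real.log_le_sub_one_of_pos ht0
  push_cast
  linarith

/-- `β ≤ exp(a/U)` from `U ≤ a/(1 + log β)`. -/
theorem le_exp_div_of_le {a U β : ℝ} (hU : 0 < U) (hβ : 1 ≤ β)
    (hUa : U ≤ a / (1 + Real.log β)) : β ≤ Real.exp (a / U) := by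
  have hlog : 0 ≤ Real.log β := Real.log_nonneg hβ
  have h1 : U * (1 + Real.log β) ≤ a := by
    rwa [le_div_iff₀ (by linarith)] at hUa
  have h2 : Real.log β ≤ a / U := by
    rw [le_div_iff₀ hU]; nlinarith
  calc β = Real.exp (Real.log β) := (Real.exp_log (by linarith)).symm
    _ ≤ Real.exp (a / U) := Real.exp_le_exp.mpr h2

end Summit.HubbardSuperconductivity.HubbardSuperconductivity.Theorems.TwSourcedInertness.Negative
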